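import Summits.PneNP.PneNP.Theses.ChebyshevTracialDesign
import HarnessLib

/-!
# Route `ChebyshevTracialDesign`: the exp-normalised decay crux is weaker than the log-normalised one

`Summit.PneNP.PneNP.Theses.ChebyshevTracialDesign.TracialDecay20` (tracial value `≤ n^{-a·dq n}` in the
budget `r²·n < n^{a·dq n}`) implies `…TracialDecayExp20` (value `≤ exp(-a·dq n)` in the budget
`r²·n < exp(a·dq n)`) with the same rate `a`: for `n ≥ 3` one has `log n ≥ 1`, so `exp(a·D) ≤ n^{a·D}`
(the exp budget is smaller) and `n^{-a·D} ≤ exp(-a·D)` (the exp threshold is weaker); the tracial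
value bound is monotone in the threshold. This is the planner's kernel sketch `exp_of_log`
(HOME/pnp-psdrank-p1/route-B/Sketch_exp.lean) stated against the route's own decls, so that a proof of the
aside `TracialDecay20` (stmt-PneNP-19646) also closes the cone crux `TracialDecayExp20` (stmt-PneNP-19878).
-/

set_option linter.dupNamespace false -- `Summit.PneNP.PneNP.…`: summit = sub-problem (D-0017)

noncomputable section

open Real
open Literature.Combinatorics.Optimization Literature.Barriers.PneNP

namespace Summit.PneNP.PneNP.Theorems

namespace ChebyshevTracialDesignAssembly

/-- Monotonicity of `TracialValueLEAt` in the threshold. [cite: GriblingDelaatLaurent2019, §5; elementary] -/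
theorem tracialValueLEAt_mono {n : ℕ} (W : OddSet n → PMatch n → ℝ) {γ γ' : ℝ} (h : γ ≤ γ')
    (r : ℕ) (hW : TracialValueLEAt W γ r) : TracialValueLEAt W γ' r :=
  fun X Y hXY => le_trans (hW X Y hXY) h

/-- For `n ≥ 3` and `0 ≤ x`: `exp x ≤ n ^ x`. [cite: Rothvoss2017, §2 (PDF pp. 6–8); elementary] -/
theorem exp_le_natCast_rpow {n : ℕ} (hn : 3 ≤ n) {x : ℝ} (hx : 0 ≤ x) :
    Real.exp x ≤ (n : ℝ) ^ x := by
  have hnpos : (0 : ℝ) < n := by exact_mod_cast (lt_of_lt_of_le (by norm_num) hn)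
  have hlog : 1 ≤ Real.log (n : ℝ) := by
    rw [Real.le_log_iff_exp_le hnpos]
    have h3 : (3 : ℝ) ≤ n := by exact_mod_cast hn
    have := Real.exp_one_lt_d9
    linarith
  rw [Real.rpow_def_of_pos hnpos, Real.exp_le_exp]
  nlinarith

end ChebyshevTracialDesignAssembly

open ChebyshevTracialDesignAssembly
open Summit.PneNP.PneNP.Theses.ChebyshevTracialDesign

/-- **`TracialDecay20 → TracialDecayExp20`** (route `ChebyshevTracialDesign`): the log-normalised
dimension-restricted tracial decay of balanced Chebyshev designs implies the exp-normalised one with the same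
rate `a` (smaller budget, weaker threshold). [cite: Rothvoss2017, §2 (PDF pp. 6–8)] -/
theorem TracialDecayExp20_of_TracialDecay20
    (h : Summit.PneNP.PneNP.Theses.ChebyshevTracialDesign.TracialDecay20) :
    Summit.PneNP.PneNP.Theses.ChebyshevTracialDesign.TracialDecayExp20 := by
  obtain ⟨a, ha, n₁, h₁⟩ := h
  refine ⟨a, ha, max n₁ 3, fun n hn hev t C w hdes r hr hbud => ?_⟩
  have hn₁ : n₁ ≤ n := le_trans (le_max_left _ _) hn
  have hn3 : (3 : ℕ) ≤ n := le_trans (le_max_right _ _) hn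
  have hnpos : (0 : ℝ) < n := by exact_mod_cast (lt_of_lt_of_le (by norm_num) hn3)
  have hD : 0 ≤ a * (dq n : ℝ) := mul_nonneg ha.le (by positivity)
  have hbud' : (r : ℝ) ^ 2 * n < (n : ℝ) ^ (a * (dq n : ℝ)) :=
    lt_of_lt_of_le hbud (exp_le_natCast_rpow hn3 hD)
  refine tracialValueLEAt_mono _ ?_ r (h₁ n hn₁ hev t C w hdes r hr hbud')
  rw [Real.rpow_neg hnpos.le, Real.exp_neg]
  exact inv_anti₀ (Real.exp_pos _) (exp_le_natCast_rpow hn3 hD)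

end Summit.PneNP.PneNP.Theorems
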